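import Mathlib

/-!
# `GrenetZeon.DualUnipotentThreeHalves` (stmt-ValiantsHypothesis-24318), R2 heavy-top instrument — P-Q1 Level-1 assembly helpers:
# block powers of a matrix with zero border row, and the dimension of a COORDINATE WINDOW (support lemmas for `…HeavyTopLevelOne`)

Experiment cell «val-heavytop-census» (D-0160), engine seat val-htc-eng-2 g3 (kernel-only lane; P-Q1 port, eng lineage, R336 (5) / R340 (3)).
Two generic, definition-free facts used by the Level-1 assembly of the lead's pencil proof `lead-g2/Q1-PROOF.md` (the dimension count
(L1.b) and the «full piece ⇒ it contains the unit vectors» steps of (L1.c)/(L1.d)):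

* `submatrix_castSucc_pow` — if the border row of `M ∈ M_{s+1}(ℂ)` vanishes, the block of `M^k` is the `k`-th power of the block of `M`
  (`(M^k).submatrix castSucc castSucc = (M.submatrix castSucc castSucc)^k`); so a block-plus-border-free matrix with `M^p = 0` has a
  block with `p`-th power zero (`submatrix_castSucc_pow_eq_zero`);
* `finrank_le_of_window` — a linear space `C` of vectors in `ℂ^m` supported in the index window `[lo, hi)` has `finrank C ≤ hi − lo`;
  `single_mem_of_finrank_eq_window` — if equality holds, `C` contains every unit vector `e_i`, `lo ≤ i < hi`.

Honest framing: helpers for the instrument's kernel port P-Q1; nothing here proves or refutes `HeavyTopLaw`/`HeavyTopSlowLaw`, 24318, S3 or 8062;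
`VP ≠ VNP` is NOT proved.  No definitions.  [folklore; this seat]
-/

noncomputable section

-- single-conjunct layout: Sub = Summit, duplicated namespace component intended
set_option linter.dupNamespace false

namespace Summit.ValiantsHypothesis.ValiantsHypothesis.Theorems.GrenetZeon.HeavyTopBorderPieces

open Matrix

/-! ## Block powers -/

/-- If the border row `last` of `M` vanishes, taking the principal block commutes with powers. -/
theorem submatrix_castSucc_pow {s : ℕ} (M : Matrix (Fin (s + 1)) (Fin (s + 1)) ℂ) (hrow : ∀ b, M (Fin.last s) b = 0) (k : ℕ) :
    (M ^ k).submatrix Fin.castSucc Fin.castSucc = (M.submatrix Fin.castSucc Fin.castSucc) ^ k := by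
  induction k with
  | zero =>
    ext i j
    simp only [pow_zero, Matrix.submatrix_apply, Matrix.one_apply, Fin.castSucc_inj]
  | succ k ih =>
    rw [pow_succ, pow_succ, ← ih]
    ext i j
    simp only [Matrix.submatrix_apply, Matrix.mul_apply]
    rw [Fin.sum_univ_castSucc, hrow, mul_zero, add_zero]

/-- Hence: border row zero and `M^p = 0` ⇒ the block has `p`-th power zero. -/
theorem submatrix_castSucc_pow_eq_zero {s : ℕ} (M : Matrix (Fin (s + 1)) (Fin (s + 1)) ℂ) (hrow : ∀ b, M (Fin.last s) b = 0)
    {p : ℕ} (hM : M ^ p = 0) : (M.submatrix Fin.castSucc Fin.castSucc) ^ p = 0 := by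
  rw [← submatrix_castSucc_pow M hrow p, hM]
  rfl

/-! ## Coordinate windows -/

/-- **Window bound.**  If every vector of `C ≤ ℂ^m` vanishes outside the index window `[lo, hi)` (`hi ≤ m`), then `finrank C ≤ hi − lo`. -/
theorem finrank_le_of_window {m : ℕ} (C : Submodule ℂ (Fin m → ℂ)) (lo hi : ℕ) (hhi : hi ≤ m)
    (hC : ∀ u ∈ C, ∀ i : Fin m, (i.val < lo ∨ hi ≤ i.val) → u i = 0) : Module.finrank ℂ C ≤ hi - lo := by
  classical
  -- restriction to the window
  let r : (Fin m → ℂ) →ₗ[ℂ] (Fin (hi - lo) → ℂ) :=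
    { toFun := fun u k => u ⟨lo + k.val, by omega⟩
      map_add' := fun u v => by funext k; rfl
      map_smul' := fun c u => by funext k; rfl }
  have hinj : Function.Injective (r.comp C.subtype) := by
    intro u v huv
    apply Subtype.ext
    funext i
    by_cases hiw : i.val < lo ∨ hi ≤ i.val
    · rw [hC u u.2 i hiw, hC v v.2 i hiw]
    · have hk : i.val - lo < hi - lo := by omega
      have e := congr_fun huv ⟨i.val - lo, hk⟩
      have hi' : (⟨lo + (i.val - lo), by omega⟩ : Fin m) = i := Fin.ext (by simp; omega)
      simpa [r, hi'] using e
  have h := LinearMap.finrank_le_finrank_of_injective hinj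
  simpa using h

/-- **Full window.**  If moreover `finrank C = hi − lo`, then `C` contains the unit vectors of the window. -/
theorem single_mem_of_finrank_eq_window {m : ℕ} (C : Submodule ℂ (Fin m → ℂ)) (lo hi : ℕ) (hhi : hi ≤ m)
    (hC : ∀ u ∈ C, ∀ i : Fin m, (i.val < lo ∨ hi ≤ i.val) → u i = 0) (heq : Module.finrank ℂ C = hi - lo)
    (i : Fin m) (hlo : lo ≤ i.val) (hih : i.val < hi) : (Pi.single i (1 : ℂ) : Fin m → ℂ) ∈ C := by
  classical
  let r : (Fin m → ℂ) →ₗ[ℂ] (Fin (hi - lo) → ℂ) :=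
    { toFun := fun u k => u ⟨lo + k.val, by omega⟩
      map_add' := fun u v => by funext k; rfl
      map_smul' := fun c u => by funext k; rfl }
  have hinj : Function.Injective (r.comp C.subtype) := by
    intro u v huv
    apply Subtype.ext
    funext j
    by_cases hj : j.val < lo ∨ hi ≤ j.val
    · rw [hC u u.2 j hj, hC v v.2 j hj]
    · have hk : j.val - lo < hi - lo := by omega
      have e := congr_fun huv ⟨j.val - lo, hk⟩
      have hj' : (⟨lo + (j.val - lo), by omega⟩ : Fin m) = j := Fin.ext (by simp; omega)
      simpa [r, hj'] using e
  have hsurj : Function.Surjective (r.comp C.subtype) :=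
    (LinearMap.injective_iff_surjective_of_finrank_eq_finrank (by simpa using heq)).1 hinj
  obtain ⟨⟨u, huC⟩, hu⟩ := hsurj (Pi.single ⟨i.val - lo, by omega⟩ 1)
  have hui : u = Pi.single i 1 := by
    funext j
    by_cases hj : j.val < lo ∨ hi ≤ j.val
    · rw [hC u huC j hj, Pi.single_apply, if_neg]
      exact fun e => by subst e; omega
    · have hk : j.val - lo < hi - lo := by omega
      have e := congr_fun hu ⟨j.val - lo, hk⟩
      have hj' : (⟨lo + (j.val - lo), by omega⟩ : Fin m) = j := Fin.ext (by simp; omega)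
      simp only [LinearMap.coe_comp, Function.comp_apply, Submodule.coe_subtype, LinearMap.coe_mk, AddHom.coe_mk, r, hj'] at e
      rw [e, Pi.single_apply, Pi.single_apply]
      by_cases hji : j = i
      · subst hji; simp
      · rw [if_neg hji, if_neg]
        exact fun e' => hji (Fin.ext (by rw [Fin.ext_iff] at e'; simp at e'; omega))
  rw [← hui]; exact huC

/-! ## The border projections (appended for the Level-1 assembly) -/

/-- The column-`ω` projection of `Z` is the outer product `u ⊗ e_ω`, `u_i = Z_{iω}` (`i ≠ ω`), `u_ω = 0`. -/
theorem colP_eq_vecMulVec {s : ℕ} (Z : Matrix (Fin (s + 1)) (Fin (s + 1)) ℂ) :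
    (Matrix.of fun a b : Fin (s + 1) => if a ≠ Fin.last s ∧ b = Fin.last s then Z a b else 0) =
      vecMulVec (fun i => if i = Fin.last s then 0 else Z i (Fin.last s)) (Pi.single (Fin.last s) (1 : ℂ)) := by
  ext a b
  simp only [Matrix.of_apply, vecMulVec_apply, Pi.single_apply]
  by_cases ha : a = Fin.last s <;> by_cases hb : b = Fin.last s <;> simp [ha, hb]

/-- The row-`ω` projection of `Z` is the outer product `e_ω ⊗ w`, `w_j = Z_{ωj}` (`j ≠ ω`), `w_ω = 0`. -/
theorem rowP_eq_vecMulVec {s : ℕ} (Z : Matrix (Fin (s + 1)) (Fin (s + 1)) ℂ) :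
    (Matrix.of fun a b : Fin (s + 1) => if a = Fin.last s ∧ b ≠ Fin.last s then Z a b else 0) =
      vecMulVec (Pi.single (Fin.last s) (1 : ℂ)) (fun j => if j = Fin.last s then 0 else Z (Fin.last s) j) := by
  ext a b
  simp only [Matrix.of_apply, vecMulVec_apply, Pi.single_apply]
  by_cases ha : a = Fin.last s <;> by_cases hb : b = Fin.last s <;> simp [ha, hb]

/-- A matrix unit is an outer product of unit vectors. -/
theorem single_eq_vecMulVec {m : ℕ} (a b : Fin m) :
    Matrix.single a b (1 : ℂ) = vecMulVec (Pi.single a (1 : ℂ)) (Pi.single b (1 : ℂ)) := by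
  ext i j
  rw [vecMulVec_apply, Pi.single_apply, Pi.single_apply]
  by_cases hi : i = a
  · by_cases hj : j = b
    · subst hi; subst hj; simp
    · subst hi
      rw [Matrix.single_apply_of_ne _ _ _ _ _ (fun h => hj h.2.symm)]; simp [hj]
  · rw [Matrix.single_apply_of_ne _ _ _ _ _ (fun h => hi h.1.symm)]; simp [hi]

/-- A matrix with zero corner is the sum of its row-`ω`, block and column-`ω` projections. -/
theorem eq_rowP_add_blkP_add_colP {s : ℕ} (Z : Matrix (Fin (s + 1)) (Fin (s + 1)) ℂ) (hZ : Z (Fin.last s) (Fin.last s) = 0) :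
    Z = (Matrix.of fun a b : Fin (s + 1) => if a = Fin.last s ∧ b ≠ Fin.last s then Z a b else 0) +
        (Matrix.of fun a b : Fin (s + 1) => if a ≠ Fin.last s ∧ b ≠ Fin.last s then Z a b else 0) +
        (Matrix.of fun a b : Fin (s + 1) => if a ≠ Fin.last s ∧ b = Fin.last s then Z a b else 0) := by
  ext a b
  simp only [Matrix.add_apply, Matrix.of_apply]
  by_cases ha : a = Fin.last s <;> by_cases hb : b = Fin.last s
  · subst ha; subst hb; simp [hZ]
  · simp [ha, hb]
  · simp [ha, hb]
  · simp [ha, hb]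

end Summit.ValiantsHypothesis.ValiantsHypothesis.Theorems.GrenetZeon.HeavyTopBorderPieces

end
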